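import Summits.RiemannHypothesis.RiemannHypothesis.Theorems.SpectralTraceHeckeSurrogateDefs
import Literature.NumberTheory.LFunctions.WeilMellinPolyDecay
import Literature.NumberTheory.LFunctions.EntireZeroSum
import HarnessLib

/-!
# The zero side of an entire function over its zeros with multiplicity — stub `stub_zeroSumLimit`

Route `RiemannHypothesis/SpectralTrace`, crux `WindowTracePrime2` (stmt-RiemannHypothesis-11196),
line `hecke-cusp-perturbation-surrogate`, registered stub **E** `stub_zeroSumLimit`
(skeleton `Cruxes/WindowTracePrime2/Lines/hecke_cusp_perturbation_surrogate.lean`; vocabulary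
`Theorems/SpectralTraceHeckeSurrogateDefs.lean`: `ZIdx E`, `zval`, `ZeroCountBound E`).

For `E` entire, not identically zero, with `ZeroCountBound E` (zeros in a strip `|Re ρ - 1/2| ≤ A`,
at most `A (2+|T|)^A` zeros with multiplicity in each unit window `|Im ρ - T| ≤ 1`) and all zeros
in the open strip `1 - σ < Re s < σ`, and for every Weil test function `g`:

* the zero side `Σ_{i : ZIdx E} ĝ(zval i)` (multiplicity by `analyticOrderNatAt`, built into the
  index type) converges absolutely — decay `‖ĝ(s)‖ ≤ D/(1 + (Im s)²)^{k+1}` on the strip with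
  `k = ⌈A⌉₊` (`Literature.NumberTheory.LFunctions.norm_weilMellin_le_pow_of_abs_re_le`) against the
  unit-window counts (`Literature.NumberTheory.LFunctions.summable_of_unit_window_ncard_le`);
* the rectangle zero sums `Σ_{ρ ∈ (1-σ,σ)×(-T_n,T_n), E(ρ)=0} m(ρ) ĝ(ρ)` (multiplicity by
  `meromorphicOrderAt`, the raw `finsum` form of the contour engine) tend to `∑' i, ĝ(zval i)`
  along ANY `T_n → +∞`: regroup the `ZIdx`-sum fibrewise over the zeros (`HasSum.sigma`), identify
  `(meromorphicOrderAt E ρ).untop₀ = analyticOrderNatAt E ρ` (finite orders, `E ≢ 0`), and note that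
  the finite sets of zeros with `|Im ρ| < T_n` exhaust (template:
  `Theorems/WindowTracePrime2/Negative/LoadBearing.hasSum_nontrivialZeros`,
  `Literature.NumberTheory.LFunctions.EntireEF.tendsto_zeroFinset`).

References: E. Bombieri, *Remarks on Weil's quadratic functional in the theory of prime numbers I*,
Rend. Mat. Acc. Lincei (9) 11 (2000), §2 Thm 2 [Bombieri2000Weil]; H. L. Montgomery, R. C. Vaughan,
*Multiplicative Number Theory I* (2007), Thm. 10.17 [MontgomeryVaughan2007].
-/

noncomputable section

set_option linter.dupNamespace false

namespace Summit.RiemannHypothesis.RiemannHypothesis.Theorems.HeckeSurrogate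

open Complex Filter Set MeasureTheory
open scoped Real Topology
open Literature.NumberTheory.LFunctions
open Literature.Uncategorized

/-! ## Multiplicities and finiteness -/

/-- For an entire `E` not identically zero, the meromorphic multiplicity at any point is the order
of vanishing: `(meromorphicOrderAt E ρ).untop₀ = analyticOrderNatAt E ρ` (all orders are finite).
[folklore] -/
theorem zsl_untop₀_meromorphicOrderAt {E : ℂ → ℂ} (hE : Differentiable ℂ E) {c : ℂ} (hc : E c ≠ 0)
    (ρ : ℂ) : (((meromorphicOrderAt E ρ).untop₀ : ℤ) : ℂ) = (analyticOrderNatAt E ρ : ℂ) := by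
  rw [(hE.analyticAt ρ).meromorphicOrderAt_eq,
    ← Nat.cast_analyticOrderNatAt (EntireEF.analyticOrderAt_ne_top_of_entire hE hc ρ)]
  simp

/-- The zeros of an entire `E ≢ 0` in an open rectangle `(1-σ, σ) × (-T, T)` form a finite set.
[folklore] -/
theorem zsl_finite_rect {E : ℂ → ℂ} (hE : Differentiable ℂ E) {c : ℂ} (hc : E c ≠ 0) (σ T : ℝ) :
    {ρ : ℂ | E ρ = 0 ∧ ρ ∈ Set.Ioo (1 - σ) σ ×ℂ Set.Ioo (-T) T}.Finite := by
  refine (EntireEF.finite_zeros_of_entire hE hc ((isCompact_Icc (a := 1 - σ) (b := σ)).reProdIm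
    (isCompact_Icc (a := -T) (b := T)))).subset ?_
  rintro ρ ⟨h0, hre, him⟩
  exact ⟨Complex.mem_reProdIm.2 ⟨Ioo_subset_Icc_self hre, Ioo_subset_Icc_self him⟩, h0⟩

/-! ## Absolute convergence of the zero side -/

/-- **Absolute convergence of the zero side over `ZIdx E`.** Under `ZeroCountBound E`, for every
Weil test function `g`: `Σ_{i : ZIdx E} ‖ĝ(zval i)‖ < ∞` (decay of order `⌈A⌉₊ + 1` on the strip
`|Re s - 1/2| ≤ A` containing the zeros, against `≤ A(2+|m|)^A` indices per unit window).
[cite: Bombieri2000Weil, §2] -/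
theorem zsl_summable_norm {E : ℂ → ℂ} (hZ : ZeroCountBound E) {g : ℝ → ℂ} (hg : IsWeilTest g) :
    Summable (fun i : ZIdx E => ‖weilMellin g (zval i)‖) := by
  obtain ⟨A, hstrip, hwin⟩ := hZ
  obtain ⟨D, hD0, hD⟩ := norm_weilMellin_le_pow_of_abs_re_le hg A (⌈A⌉₊ + 1)
  exact summable_of_unit_window_ncard_le (fun i : ZIdx E => (zval i).im) (Nat.le_ceil A) hD0
    (fun m => hwin m) (fun i => norm_nonneg _) (fun i => hD _ (hstrip _ i.1.2))

/-! ## The registered stub -/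

/-- **`stub_zeroSumLimit`** (registered stub E of the line `hecke-cusp-perturbation-surrogate`, crux
stmt-RiemannHypothesis-11196). For `E` entire, not identically zero, with `ZeroCountBound E` and all
zeros in the open strip `1-σ < Re s < σ`: the zero side over `ZIdx E` is absolutely summable for
every Weil test, and the rectangle zero sums (multiplicity by `meromorphicOrderAt`) tend to
`∑' i, ĝ(zval i)` along ANY `T_n → +∞`. Absolute convergence is `zsl_summable_norm`; for the limit,
`HasSum` over `ZIdx E` regroups fibrewise (`HasSum.sigma`) into `HasSum` of `ρ ↦ m(ρ) ĝ(ρ)` over the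
zeros, the finite sets `{ρ : E ρ = 0, |Im ρ| < T_n}` tend to `atTop`, and on them the `finsum` of the
statement is that `Finset` sum (`(meromorphicOrderAt E ρ).untop₀ = analyticOrderNatAt E ρ`).
[cite: Bombieri2000Weil, §2 Thm 2] -/
theorem stub_zeroSumLimit :
    ∀ E : ℂ → ℂ, Differentiable ℂ E → (∃ s : ℂ, E s ≠ 0) → ZeroCountBound E →
      ∀ σ : ℝ, (∀ s : ℂ, E s = 0 → 1 - σ < s.re ∧ s.re < σ) →
        ∀ g : ℝ → ℂ, IsWeilTest g →
          Summable (fun i : ZIdx E => ‖weilMellin g (zval i)‖) ∧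
          ∀ T : ℕ → ℝ, Tendsto T atTop atTop →
            Tendsto (fun n : ℕ => ∑ᶠ ρ ∈ {ρ : ℂ | E ρ = 0 ∧ ρ ∈ Set.Ioo (1 - σ) σ ×ℂ Set.Ioo (-(T n)) (T n)},
                ((meromorphicOrderAt E ρ).untop₀ : ℂ) * weilMellin g ρ) atTop
              (𝓝 (∑' i : ZIdx E, weilMellin g (zval i))) := by
  classical
  intro E hE hne hZ σ hσ g hg
  have hsum : Summable (fun i : ZIdx E => ‖weilMellin g (zval i)‖) := zsl_summable_norm hZ hg
  refine ⟨hsum, fun T hT => ?_⟩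
  obtain ⟨c, hc⟩ := hne
  set L : ℂ := ∑' i : ZIdx E, weilMellin g (zval i) with hL
  -- the zero side over `ZIdx E` and its fibrewise regrouping over the zeros
  have h1 : HasSum (fun i : (Σ ρ : {s : ℂ // E s = 0}, Fin (analyticOrderNatAt E ρ.1)) =>
      weilMellin g i.1.1) L := hsum.of_norm.hasSum
  have h2 : HasSum (fun ρ : {s : ℂ // E s = 0} =>
      (analyticOrderNatAt E ρ.1 : ℂ) * weilMellin g ρ.1) L := by
    refine (h1.sigma fun ρ => hasSum_fintype _).congr_fun fun ρ => ?_
    simp only [Finset.sum_const, Finset.card_univ, Fintype.card_fin, nsmul_eq_mul]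
  -- the finite sets of zeros with `|Im ρ| < T n`
  have hfin : ∀ n, {ρ : ℂ | E ρ = 0 ∧ ρ ∈ Set.Ioo (1 - σ) σ ×ℂ Set.Ioo (-(T n)) (T n)}.Finite :=
    fun n => zsl_finite_rect hE hc σ (T n)
  set J : ℕ → Finset {s : ℂ // E s = 0} := fun n =>
    ((hfin n).preimage Subtype.val_injective.injOn).toFinset with hJ
  have hmemJ : ∀ n (ρ : {s : ℂ // E s = 0}), ρ ∈ J n ↔ |(ρ : ℂ).im| < T n := by
    intro n ρ
    simp only [hJ, Set.Finite.mem_toFinset, Set.mem_preimage, Set.mem_setOf_eq,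
      Complex.mem_reProdIm, Set.mem_Ioo, abs_lt]
    exact ⟨fun h => h.2.2, fun h => ⟨ρ.2, hσ _ ρ.2, h⟩⟩
  -- they exhaust the zeros
  have hJT : Tendsto J atTop atTop := by
    refine tendsto_atTop.2 fun s => ?_
    filter_upwards [hT.eventually_gt_atTop (∑ ρ ∈ s, |(ρ : ℂ).im|)] with n hn
    intro ρ hρ
    rw [hmemJ]
    exact lt_of_le_of_lt (Finset.single_le_sum (f := fun ρ : {s : ℂ // E s = 0} => |(ρ : ℂ).im|)
      (fun ρ _ => abs_nonneg _) hρ) hn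
  -- on them the `finsum` of the statement is the `Finset` sum of `m(ρ) ĝ(ρ)`
  have hA : ∀ n, ∑ᶠ ρ ∈ {ρ : ℂ | E ρ = 0 ∧ ρ ∈ Set.Ioo (1 - σ) σ ×ℂ Set.Ioo (-(T n)) (T n)},
      ((meromorphicOrderAt E ρ).untop₀ : ℂ) * weilMellin g ρ =
        ∑ ρ ∈ J n, (analyticOrderNatAt E ρ.1 : ℂ) * weilMellin g ρ.1 := by
    intro n
    rw [finsum_mem_eq_finite_toFinset_sum _ (hfin n)]
    have e : ∑ ρ ∈ J n, (analyticOrderNatAt E ρ.1 : ℂ) * weilMellin g ρ.1 =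
        ∑ z ∈ (J n).map (Function.Embedding.subtype _),
          (analyticOrderNatAt E z : ℂ) * weilMellin g z := by
      rw [Finset.sum_map]; rfl
    rw [e]
    refine Finset.sum_congr ?_ fun ρ _ => by rw [zsl_untop₀_meromorphicOrderAt hE hc]
    ext z
    simp only [Finset.mem_map, Function.Embedding.subtype_apply, Set.Finite.mem_toFinset, hJ,
      Set.mem_preimage]
    constructor
    · intro hz
      exact ⟨⟨z, hz.1⟩, hz, rfl⟩
    · rintro ⟨ρ, hρ, rfl⟩
      exact hρ
  have h3 : Tendsto (fun n => ∑ ρ ∈ J n, (analyticOrderNatAt E ρ.1 : ℂ) * weilMellin g ρ.1)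
      atTop (𝓝 L) := h2.comp hJT
  exact h3.congr fun n => (hA n).symm

end Summit.RiemannHypothesis.RiemannHypothesis.Theorems.HeckeSurrogate

end
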